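import Mathlib
import Summits.MatrixMultiplication.MatrixMultiplication.Theorems.GradedDesignFamily.Negative.SubfieldCellUnipotent
import Literature.NumberTheory.GaloisRepresentations.SL2WreathResidualImage

/-!
# Orbits of `φ(SL₂ k)` on `K²` in the quadratic-extension cell
# (crux `LevelGradedCohnUmans.GradedDesignFamily`, stmt-MatrixMultiplication-7610; negative side,
# line `quadratic-extension-level-one-cell`, stub S3 `stub_subfieldCell`)

HONEST FRAMING.  Support for DECIDING the finite cells `q = 4, 5` of S3 by theorem (the
cusp-form wall `CuspFormWall`); not summit progress.

For an ARBITRARY injective hom `φ : SL₂(k) →* GL₂(K)` with `|K| = |k|²` (S3's data) we prove the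
orbit structure of `φ(SL₂ k)` acting on `K² ∖ 0`:

* `subfieldCell_stab_le_conj` — every stabiliser `Stab_φ(v)` (`v ≠ 0`) lies in a conjugate
  `b U b⁻¹` of the root group `U = {u_x}` (it is a `p`-group by
  `subfieldCell_pow_char_of_fixed`; `U` is a Sylow `p`-subgroup; Sylow's theorems);
* `subfieldCell_stab_eq_conj` — a non-trivial stabiliser IS such a conjugate (the fixed line of
  an abelian unipotent group, `fin_two_commuting_sqZero_mulVec`);
* `fin_two_card_filter_mulVec_eq_zero` — the kernel of a non-zero square-zero `2 × 2` matrix is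
  a line (`|K|` points);
* `subfieldCell_orbitReps` — **the dichotomy with a count**: there is a set `Reps ⊆ K²` of at
  most `|k| − 1` points such that every `w ≠ 0` is either `φ(s) v` for some `v ∈ Reps`, or has
  stabiliser exactly a conjugate of `U`.  (The `q + 1` root groups `U_j` have pairwise disjoint
  punctured fixed lines of `|K| − 1` non-free points each, so at most
  `|K|² − 1 − (q+1)(|K| − 1) = (q − 1)·|SL₂(k)|` points are free, i.e. at most `q − 1` free orbits.)

Sorry-free; axioms `propext`, `Classical.choice`, `Quot.sound`.
-/

set_option linter.dupNamespace false

open scoped BigOperators Pointwise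
open Matrix

namespace Summit.MatrixMultiplication.MatrixMultiplication.Theorems.GradedDesignFamily.Negative

section FinTwo

variable {K : Type} [Field K] [Fintype K] [DecidableEq K]

/-- The kernel of a non-zero square-zero `2 × 2` matrix over a finite field is a line: exactly
`|K|` vectors. [folklore] -/
theorem fin_two_card_filter_mulVec_eq_zero (N : Matrix (Fin 2) (Fin 2) K) (hN : N ≠ 0)
    (hNN : N * N = 0) :
    (Finset.univ.filter fun v : Fin 2 → K => N *ᵥ v = 0).card = Fintype.card K := by
  -- a non-zero column `v₀` of `N`; it lies in the kernel since `N² = 0`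
  obtain ⟨i, j, hij⟩ : ∃ i j, N i j ≠ 0 := by
    by_contra h
    push Not at h
    exact hN (Matrix.ext fun i j => by simpa using h i j)
  set v₀ : Fin 2 → K := fun r => N r j with hv₀_def
  have hv₀ : v₀ ≠ 0 := fun h => hij (by simpa [hv₀_def] using congr_fun h i)
  have hNv₀ : N *ᵥ v₀ = 0 := by
    funext r
    have : (N * N) r j = 0 := by rw [hNN]; rfl
    simpa [Matrix.mulVec, dotProduct, Matrix.mul_apply, hv₀_def] using this
  have heq : (Finset.univ.filter fun v : Fin 2 → K => N *ᵥ v = 0) =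
      Finset.univ.image fun c : K => c • v₀ := by
    ext v
    simp only [Finset.mem_filter, Finset.mem_univ, true_and, Finset.mem_image]
    constructor
    · intro hv
      obtain ⟨c, hc⟩ := fin_two_exists_smul_of_mulVec_eq_zero N hN v₀ v hv₀ hNv₀ hv
      exact ⟨c, hc.symm⟩
    · rintro ⟨c, rfl⟩
      rw [Matrix.mulVec_smul, hNv₀, smul_zero]
  rw [heq, Finset.card_image_of_injective _ (smul_left_injective K hv₀), Finset.card_univ]

end FinTwo

section Cell

variable {k K : Type} [Field k] [Fintype k] [DecidableEq k] [Field K] [Fintype K] [DecidableEq K]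

/-- **Stabilisers lie in conjugates of the root group.**  For `φ : SL₂(k) →* GL₂(K)` injective
with `|K| = |k|²` and `v ∈ K² ∖ 0`, there is `b ∈ SL₂(k)` with
`Stab_φ(v) ⊆ {b u_x b⁻¹ : x ∈ k}`: the stabiliser is a `p`-group
(`subfieldCell_pow_char_of_fixed`), `U = {u_x}` is a Sylow `p`-subgroup of `SL₂(k)`
(`|U| = q`, `|SL₂(k)| = q(q² − 1)`), and Sylow subgroups are conjugate. [folklore] -/
theorem subfieldCell_stab_le_conj
    (φ : Matrix.SpecialLinearGroup (Fin 2) k →* Matrix.GeneralLinearGroup (Fin 2) K)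
    (hφ : Function.Injective φ) (hK : Fintype.card K = Fintype.card k ^ 2)
    (v : Fin 2 → K) (hv : v ≠ 0) :
    ∃ b : Matrix.SpecialLinearGroup (Fin 2) k, ∀ t : Matrix.SpecialLinearGroup (Fin 2) k,
      ((φ t : Matrix.GeneralLinearGroup (Fin 2) K) : Matrix (Fin 2) (Fin 2) K) *ᵥ v = v →
        ∃ x : k, t = b * ⟨!![(1 : k), x; 0, 1], sl2md_det_upper x⟩ * b⁻¹ := by
  classical
  set p := ringChar k with hp_def
  haveI hprime : Fact p.Prime := ⟨CharP.char_is_prime k p⟩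
  obtain ⟨n, -, hq⟩ := FiniteField.card k p
  -- the root group `U = {u_x}` as the range of `x ↦ u_x`
  let uH : Multiplicative k →* Matrix.SpecialLinearGroup (Fin 2) k :=
    { toFun := fun x => ⟨!![(1 : k), Multiplicative.toAdd x; 0, 1], sl2md_det_upper _⟩
      map_one' := by
        refine Matrix.SpecialLinearGroup.ext _ _ fun i j => ?_
        rw [Matrix.SpecialLinearGroup.coe_one]
        fin_cases i <;> fin_cases j <;> simp
      map_mul' := fun x y => by
        simpa [toAdd_mul] using
          (sl2md_upper_mul (K := k) (Multiplicative.toAdd x) (Multiplicative.toAdd y)).symm }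
  have huH_inj : Function.Injective uH := by
    intro x y hxy
    have h := congrArg (fun g : Matrix.SpecialLinearGroup (Fin 2) k =>
      (g : Matrix (Fin 2) (Fin 2) k) 0 1) hxy
    simpa [uH] using h
  let U : Subgroup (Matrix.SpecialLinearGroup (Fin 2) k) := uH.range
  have hUcard : Nat.card U = p ^ (n : ℕ) := by
    rw [← hq, ← Nat.card_eq_fintype_card,
      ← Nat.card_congr (MonoidHom.ofInjective huH_inj).toEquiv]
    simp [Nat.card_eq_fintype_card]
  have hSLcard : Nat.card (Matrix.SpecialLinearGroup (Fin 2) k) = p ^ (n : ℕ) * (p ^ (2 * (n : ℕ)) - 1) := by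
    rw [Literature.NumberTheory.GaloisRepresentations.SL2Wreath.natCard_specialLinearGroup_fin_two,
      hq, ← pow_mul, mul_comm (n : ℕ) 2]
  have hfact : (Nat.card (Matrix.SpecialLinearGroup (Fin 2) k)).factorization p = (n : ℕ) := by
    rw [hSLcard]
    have hne1 : p ^ (n : ℕ) ≠ 0 := pow_ne_zero _ hprime.out.ne_zero
    have h2n : 1 < p ^ (2 * (n : ℕ)) := Nat.one_lt_pow (by positivity) hprime.out.one_lt
    have hne2 : p ^ (2 * (n : ℕ)) - 1 ≠ 0 := by omega
    rw [Nat.factorization_mul hne1 hne2, Finsupp.add_apply, hprime.out.factorization_pow,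
      Finsupp.single_eq_same, Nat.factorization_eq_zero_of_not_dvd, add_zero]
    intro hd
    have h1 : p ∣ p ^ (2 * (n : ℕ)) := dvd_pow_self _ (by positivity)
    have h3 : p ∣ p ^ (2 * (n : ℕ)) - (p ^ (2 * (n : ℕ)) - 1) := Nat.dvd_sub h1 hd
    rw [show p ^ (2 * (n : ℕ)) - (p ^ (2 * (n : ℕ)) - 1) = 1 by omega] at h3
    exact hprime.out.one_lt.ne' (Nat.dvd_one.1 h3)
  let P : Sylow p (Matrix.SpecialLinearGroup (Fin 2) k) := Sylow.ofCard U (by rw [hUcard, hfact])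
  -- the stabiliser of `v`, a `p`-group
  let S : Subgroup (Matrix.SpecialLinearGroup (Fin 2) k) :=
    { carrier := {t | ((φ t : Matrix.GeneralLinearGroup (Fin 2) K) : Matrix (Fin 2) (Fin 2) K) *ᵥ v = v}
      mul_mem' := fun {s t} hs ht => by
        simp only [Set.mem_setOf_eq] at hs ht ⊢
        rw [map_mul, Units.val_mul, ← Matrix.mulVec_mulVec, ht, hs]
      one_mem' := by
        simp only [Set.mem_setOf_eq, map_one, Units.val_one, Matrix.one_mulVec]
      inv_mem' := fun {s} hs => by
        simp only [Set.mem_setOf_eq] at hs ⊢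
        have h1 : ((φ s⁻¹ : Matrix.GeneralLinearGroup (Fin 2) K) : Matrix (Fin 2) (Fin 2) K) *ᵥ
            (((φ s : Matrix.GeneralLinearGroup (Fin 2) K) : Matrix (Fin 2) (Fin 2) K) *ᵥ v) = v := by
          rw [Matrix.mulVec_mulVec, map_inv, Units.inv_mul, Matrix.one_mulVec]
        rwa [hs] at h1 }
  have hS : IsPGroup p S := by
    intro t
    refine ⟨1, Subtype.ext ?_⟩
    rw [pow_one, Subgroup.coe_pow, Subgroup.coe_one]
    exact subfieldCell_pow_char_of_fixed φ hφ hK t.1 v hv t.2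
  obtain ⟨Q, hSQ⟩ := hS.exists_le_sylow
  obtain ⟨b, hb⟩ := MulAction.exists_smul_eq (Matrix.SpecialLinearGroup (Fin 2) k) P Q
  refine ⟨b, fun t ht => ?_⟩
  have htQ : t ∈ (Q : Subgroup (Matrix.SpecialLinearGroup (Fin 2) k)) := hSQ ht
  rw [← hb, Sylow.coe_subgroup_smul] at htQ
  obtain ⟨s, hsP, hst⟩ := (Subgroup.mem_smul_pointwise_iff_exists t (MulAut.conj b) _).1 htQ
  obtain ⟨x, rfl⟩ : ∃ x, uH x = s := hsP
  refine ⟨Multiplicative.toAdd x, ?_⟩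
  rw [← hst, MulAut.smul_def, MulAut.conj_apply]
  rfl

/-- **A non-trivial stabiliser is a full conjugate of the root group.**  If moreover some
`t₀ ≠ 1` fixes `v`, then `Stab_φ(v) = {b u_x b⁻¹ : x ∈ k}`: with `N = φ(t₀) − 1 ≠ 0`,
`N² = 0`, every `N' = φ(b u_x b⁻¹) − 1` is square-zero and commutes with `N`, so it kills the
fixed line `ker N ∋ v` (`fin_two_commuting_sqZero_mulVec`). [folklore] -/
theorem subfieldCell_stab_eq_conj
    (φ : Matrix.SpecialLinearGroup (Fin 2) k →* Matrix.GeneralLinearGroup (Fin 2) K)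
    (hφ : Function.Injective φ) (hK : Fintype.card K = Fintype.card k ^ 2)
    (v : Fin 2 → K) (hv : v ≠ 0) (t₀ : Matrix.SpecialLinearGroup (Fin 2) k) (ht₀ : t₀ ≠ 1)
    (h₀ : ((φ t₀ : Matrix.GeneralLinearGroup (Fin 2) K) : Matrix (Fin 2) (Fin 2) K) *ᵥ v = v) :
    ∃ b : Matrix.SpecialLinearGroup (Fin 2) k, ∀ t : Matrix.SpecialLinearGroup (Fin 2) k,
      ((φ t : Matrix.GeneralLinearGroup (Fin 2) K) : Matrix (Fin 2) (Fin 2) K) *ᵥ v = v ↔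
        ∃ x : k, t = b * ⟨!![(1 : k), x; 0, 1], sl2md_det_upper x⟩ * b⁻¹ := by
  obtain ⟨b, hb⟩ := subfieldCell_stab_le_conj φ hφ hK v hv
  refine ⟨b, fun t => ⟨hb t, ?_⟩⟩
  rintro ⟨x, rfl⟩
  obtain ⟨x₀, hx₀⟩ := hb t₀ h₀
  set M : Matrix (Fin 2) (Fin 2) K :=
    ((φ t₀ : Matrix.GeneralLinearGroup (Fin 2) K) : Matrix (Fin 2) (Fin 2) K) with hM
  set M' : Matrix (Fin 2) (Fin 2) K :=
    ((φ (b * ⟨!![(1 : k), x; 0, 1], sl2md_det_upper x⟩ * b⁻¹) :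
      Matrix.GeneralLinearGroup (Fin 2) K) : Matrix (Fin 2) (Fin 2) K) with hM'
  -- `N = M - 1 ≠ 0`, `N v = 0`, `N² = 0`
  have hN0 : M - 1 ≠ 0 := by
    intro hz
    apply ht₀
    apply hφ
    rw [map_one]
    ext1
    rw [Units.val_one, ← hM]
    exact sub_eq_zero.1 hz
  have hNv : (M - 1) *ᵥ v = 0 := by rw [Matrix.sub_mulVec, Matrix.one_mulVec, h₀, sub_self]
  -- `N'² = 0` since `(b u_x b⁻¹)^p = 1`
  have hN'sq : (M' - 1) * (M' - 1) = 0 := by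
    refine subfieldCell_sub_one_sq_of_pow_char φ hK _ ?_
    rw [conj_pow, subfieldCell_upper_pow_char, mul_one, mul_inv_cancel]
  -- `t₀ = b u_{x₀} b⁻¹` commutes with `b u_x b⁻¹`
  have hcomm0 : t₀ * (b * ⟨!![(1 : k), x; 0, 1], sl2md_det_upper x⟩ * b⁻¹) =
      (b * ⟨!![(1 : k), x; 0, 1], sl2md_det_upper x⟩ * b⁻¹) * t₀ := by
    rw [hx₀]
    have e1 : b * ⟨!![(1 : k), x₀; 0, 1], sl2md_det_upper x₀⟩ * b⁻¹ *
        (b * ⟨!![(1 : k), x; 0, 1], sl2md_det_upper x⟩ * b⁻¹) =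
        b * (⟨!![(1 : k), x₀; 0, 1], sl2md_det_upper x₀⟩ * ⟨!![(1 : k), x; 0, 1], sl2md_det_upper x⟩) * b⁻¹ := by
      group
    have e2 : b * ⟨!![(1 : k), x; 0, 1], sl2md_det_upper x⟩ * b⁻¹ *
        (b * ⟨!![(1 : k), x₀; 0, 1], sl2md_det_upper x₀⟩ * b⁻¹) =
        b * (⟨!![(1 : k), x; 0, 1], sl2md_det_upper x⟩ * ⟨!![(1 : k), x₀; 0, 1], sl2md_det_upper x₀⟩) * b⁻¹ := by
      group
    rw [e1, e2, sl2md_upper_mul, sl2md_upper_mul, add_comm]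
  have hcommM : M * M' = M' * M := by
    rw [hM, hM', ← Units.val_mul, ← Units.val_mul, ← map_mul, ← map_mul, hcomm0]
  have hcomm : (M - 1) * (M' - 1) = (M' - 1) * (M - 1) := by
    calc (M - 1) * (M' - 1) = M * M' - M - M' + 1 := by noncomm_ring
      _ = M' * M - M' - M + 1 := by rw [hcommM]; abel
      _ = (M' - 1) * (M - 1) := by noncomm_ring
  have key := fin_two_commuting_sqZero_mulVec (M - 1) (M' - 1) hN0 hN'sq hcomm v hv hNv
  rw [Matrix.sub_mulVec, Matrix.one_mulVec, sub_eq_zero] at key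
  exact key

end Cell

end Summit.MatrixMultiplication.MatrixMultiplication.Theorems.GradedDesignFamily.Negative
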